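import Summits.QuantumFields.GaugeBoot.TiltedBoxEvenAxisRPTwoDimPrep
import Summits.QuantumFields.GaugeBoot.SlabKernelTwoLayer
import Summits.QuantumFields.GaugeBoot.TiltedBoxEvenMidAxisRPTwoDim
import HarnessLib

/-!
# Reduced-half site RP on the even square tilted box in two dimensions: integrating the two annuli and the free layer (gauge-boot, L3 supplement: 2D slab gluing, reduced-half site mirror 4a/4)

HONEST FRAMING (cell `pub-gaugeboot`, page 1 of every file): the venture produces certified bounds
on lattice expectations at stated coupling, gauge group, dimension and torus size; NOT a mass gap,
NOT a continuum limit, NOT a string tension; NOT Yang–Mills-summit-bearing (barriers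
`FixedCouplingUltralocality`, `PerturbativeInvisibility`). Measure-theoretic bookkeeping for the POSITIVE
two-dimensional result `TiltedBoxEvenAxisRPTwoDim.lean`; it discharges nothing else.

Even square box `ℤ^d/Γ(2P, 2P, L)`, `P ≥ 2`, two dimensions, site mirror `Θ_i : x_i ↦ -x_i`, reduced half
`{0 ≤ x_i ≤ P - 1}`. After the split of the Boltzmann weight (`boltzmann_split_even`) the integrand is
`h · ∏_{P-1|P} · ∏_{P|P+1}` with two annulus products of one-plaquette weights around the FREE layer `P`.

* the layer words `wA` (layer `P - 1`), `wF` (the free layer `P`), `wB` (layer `P + 1`) and `psiE = ω_β^{⋆2P}`;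
* **`integral_hEv_annuli`** — Migdal's recursion integrates the rungs of the two annuli
  (`SlabKernel.integral_mul_annulus`, twice), leaving `k_ψ(w_{P-1}, w_P) · k_ψ(w_P, w_{P+1})`; integrating ONE
  letter of the free word (`wF_update`, Haar distributed) composes them into the two-layer kernel
  `K_ψ(w_{P-1}, w_{P+1})` (`SlabKernel.integral_slabKernel_mul_slabKernel`); `w_{P+1}` is a conjugate of
  `w_{P-1} ∘ Θ_i` (`oprod_upAt_layerSite_eq_conj`, class invariance of `K_ψ`):
  `∫ h · ∏ · ∏ dμ₀ = ∫ h · K_ψ(w_{P-1}, w_{P-1}∘Θ_i) dμ₀`. The shared layer `x_i ≡ 0` needs no annulus (site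
  mirror: exact, pointwise fixed).

All `[folklore]` (Fubini on the product Haar measure; Migdal 1975, Osterwalder–Seiler 1978 §2).
References: A. A. Migdal, Sov. Phys. JETP 42 (1975) 413; K. Osterwalder, E. Seiler, Ann. Phys. 110
(1978) 440, §2; B. K. Driver, Commun. Math. Phys. 123 (1989) 575, §7.
-/

noncomputable section

open MeasureTheory Complex Function
open scoped ComplexOrder ComplexConjugate
open Literature.MathematicalPhysics.QuantumFieldTheory (haarProbability)
open Literature.MathematicalPhysics.QuantumFieldTheory.LatticeRP (piMeasure)
open Literature.RepresentationTheory.CompactGroups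

namespace Summit.QuantumFields.GaugeBoot

namespace TiltedRP

namespace TwoDim

variable {d : ℕ} {i j : Fin d} {L P N : ℕ} [NeZero L] [NeZero P]
variable {G : Type*} [Group G] [TopologicalSpace G] [IsTopologicalGroup G] [CompactSpace G]
  [MeasurableSpace G] [BorelSpace G] [SecondCountableTopology G]
variable (ρ : G →* Matrix (Fin N) (Fin N) ℂ)

/-! ## The words of the layers `P - 1`, `P`, `P + 1` and the kernel weight -/

/-- The word of the layer `P - 1` (lower letters of the annulus `P-1|P`): `w_{P-1}(U) = ∏_{t<4P} U(y₋ + t e_j, j)`. -/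
def wA (U : Config (TiltedSite d i j (2 * P) (2 * P) L) d G) : G :=
  SlabKernel.oprod (loAt (predLayerSite d L P : TiltedSite d i j (2 * P) (2 * P) L)) (2 * (2 * P)) U

/-- The word of the FREE layer `P`: `w_P(U) = ∏_{t<4P} U(y₋ + t e_j + e_i, j)`. -/
def wF (U : Config (TiltedSite d i j (2 * P) (2 * P) L) d G) : G :=
  SlabKernel.oprod (upAt (predLayerSite d L P : TiltedSite d i j (2 * P) (2 * P) L)) (2 * (2 * P)) U

/-- The word of the layer `P + 1` (upper letters of the annulus `P|P+1`). -/
def wB (U : Config (TiltedSite d i j (2 * P) (2 * P) L) d G) : G :=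
  SlabKernel.oprod (upAt (layerSite d L P : TiltedSite d i j (2 * P) (2 * P) L)) (2 * (2 * P)) U

variable (P) in
/-- The convolution power `ψ = ω_β^{⋆2P}` of the one-plaquette weight. -/
def psiE (β : ℝ) : G → ℝ := SlabKernel.convPow (SlabKernel.wilsonWt ρ β) (2 * P)

omit [NeZero L] [NeZero P] [CompactSpace G] [MeasurableSpace G] [BorelSpace G] [SecondCountableTopology G] in
/-- The layer words are continuous. [folklore] -/
theorem continuous_wordsE :
    Continuous (wA (L := L) (P := P) (i := i) (j := j) (d := d) (G := G)) ∧
    Continuous (wF (L := L) (P := P) (i := i) (j := j) (d := d) (G := G)) ∧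
    Continuous (wB (L := L) (P := P) (i := i) (j := j) (d := d) (G := G)) :=
  ⟨SlabKernel.continuous_oprod (fun _ => continuous_apply _) _, SlabKernel.continuous_oprod (fun _ => continuous_apply _) _,
    SlabKernel.continuous_oprod (fun _ => continuous_apply _) _⟩

omit [NeZero L] [NeZero P] [TopologicalSpace G] [IsTopologicalGroup G] [CompactSpace G] [MeasurableSpace G] [BorelSpace G]
  [SecondCountableTopology G] in
/-- The lower word of the annulus `P|P+1` is the free word. [folklore] -/
theorem oprod_loAt_layerSite (n : ℕ) (U : Config (TiltedSite d i j (2 * P) (2 * P) L) d G) :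
    SlabKernel.oprod (loAt (layerSite d L P : TiltedSite d i j (2 * P) (2 * P) L)) n U = SlabKernel.oprod (upAt (predLayerSite d L P : TiltedSite d i j (2 * P) (2 * P) L)) n U := by
  unfold SlabKernel.oprod
  congr 1
  exact List.map_congr_left fun t _ => loAt_layerSite_eq_upAt t U

/-! ## The two annuli are disjoint; the free letter -/

omit [NeZero L] [NeZero P] in
/-- Rungs through base sites of different layers are distinct (even box). [folklore] -/
theorem rungAt_ne_of_val_ne_even (hij : i ≠ j) {y y' : TiltedSite d i j (2 * P) (2 * P) L}
    (h : (axisCoord d L (2 * P) y).val ≠ (axisCoord d L (2 * P) y').val) (t s : ℕ) :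
    rungAt y t ≠ rungAt y' s := by
  intro he
  have h1 := congrArg (fun l => (axisCoord d L (2 * P) l.1).val) he
  simp only [rungAt, axisCoord_cyc hij] at h1
  exact h h1

omit [NeZero L] [NeZero P] in
/-- `y₋ + e_i = y₀`. [folklore] -/
theorem predLayerSite_add : (predLayerSite d L P : TiltedSite d i j (2 * P) (2 * P) L) + tiltedUnit d i j (2 * P) (2 * P) L i = layerSite d L P := by
  unfold predLayerSite
  exact sub_add_cancel _ _

omit [NeZero L] [NeZero P] in
/-- The letters above the free layer are in the layer `P + 1`: `x_i(y₀ + t e_j + e_i) = P + 1`. [folklore] -/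
theorem val_axisCoord_cyc_layerSite_add (hP : 2 ≤ P) (hij : i ≠ j) (t : ℕ) :
    (axisCoord d L (2 * P) (cyc (layerSite d L P : TiltedSite d i j (2 * P) (2 * P) L) t + tiltedUnit d i j (2 * P) (2 * P) L i)).val = P + 1 := by
  rw [← cyc_add_unit, axisCoord_cyc hij, val_axisCoord_layerSite_add hP]

omit [NeZero L] [TopologicalSpace G] [IsTopologicalGroup G] [CompactSpace G] [MeasurableSpace G] [BorelSpace G]
  [SecondCountableTopology G] in
/-- **The free word with its first letter updated**: `w_P(U[ℓ₀ ↦ z]) = z · V(U)` with `ℓ₀ = (y₋ + e_i, j)` and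
`V` the product of the remaining letters, which does not see `ℓ₀`. [folklore] -/
theorem wF_update [DecidableEq (TiltedSite d i j (2 * P) (2 * P) L)] (hij : i ≠ j) (U : Config (TiltedSite d i j (2 * P) (2 * P) L) d G) (z : G) :
    wF (update U ((predLayerSite d L P : TiltedSite d i j (2 * P) (2 * P) L) + tiltedUnit d i j (2 * P) (2 * P) L i, j) z) =
      1 * z * SlabKernel.oprod (fun t => upAt (predLayerSite d L P : TiltedSite d i j (2 * P) (2 * P) L) (1 + t)) (2 * (2 * P) - 1) U := by
  have hP : 1 ≤ P := Nat.one_le_iff_ne_zero.2 (NeZero.ne P)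
  unfold wF
  rw [show 2 * (2 * P) = 1 + (2 * (2 * P) - 1) by omega, SlabKernel.oprod_add, SlabKernel.oprod_one,
    show 1 + (2 * (2 * P) - 1) - 1 = 2 * (2 * P) - 1 by omega, one_mul]
  congr 1
  · unfold upAt
    rw [cyc_zero, update_self]
  · unfold SlabKernel.oprod
    congr 1
    refine List.map_congr_left fun t ht => ?_
    rw [List.mem_range] at ht
    show upAt (predLayerSite d L P : TiltedSite d i j (2 * P) (2 * P) L) (1 + t) (update U ((predLayerSite d L P : TiltedSite d i j (2 * P) (2 * P) L) + tiltedUnit d i j (2 * P) (2 * P) L i, j) z) =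
      upAt (predLayerSite d L P : TiltedSite d i j (2 * P) (2 * P) L) (1 + t) U
    unfold upAt
    rw [update_of_ne]
    intro he
    have h1 : cyc (predLayerSite d L P : TiltedSite d i j (2 * P) (2 * P) L) (1 + t) = cyc (predLayerSite d L P : TiltedSite d i j (2 * P) (2 * P) L) 0 := by
      rw [cyc_zero]; exact add_right_cancel (congrArg Prod.fst he)
    have := cyc_inj hij _ (by omega) (by omega) h1
    omega

/-! ## Integrating the rungs of the two annuli and the free letter -/

/-- **Two annuli integrated, the free layer composed, the twist removed**:
`∫ h · ∏_{P-1|P} · ∏_{P|P+1} dμ₀ = ∫ h · K_ψ(w_{P-1}, w_{P-1}∘Θ_i) dμ₀`. [folklore] -/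
theorem integral_hEv_annuli [DecidableEq (TiltedSite d i j (2 * P) (2 * P) L)] (hP : 2 ≤ P) (hij : i ≠ j)
    (hd : ∀ k : Fin d, k = i ∨ k = j) (hρ : Continuous ρ) (β : ℝ)
    {F : Config (TiltedSite d i j (2 * P) (2 * P) L) d G → ℂ} (hFm : Measurable F) {CF : ℝ} (hFb : ∀ U, ‖F U‖ ≤ CF)
    (hFo : ∀ U V : Config (TiltedSite d i j (2 * P) (2 * P) L) d G, (∀ l, IsRedSiteLink l → U l = V l) → F U = F V) :
    ∫ U, hEv ρ β F hij U *
        (∏ t ∈ Finset.range (2 * (2 * P)), SlabKernel.plaqWt (SlabKernel.wilsonWt ρ β) (rungAt (predLayerSite d L P : TiltedSite d i j (2 * P) (2 * P) L)) (loAt (predLayerSite d L P : TiltedSite d i j (2 * P) (2 * P) L)) (upAt (predLayerSite d L P : TiltedSite d i j (2 * P) (2 * P) L)) t U) *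
        ∏ t ∈ Finset.range (2 * (2 * P)), SlabKernel.plaqWt (SlabKernel.wilsonWt ρ β) (rungAt (layerSite d L P : TiltedSite d i j (2 * P) (2 * P) L)) (loAt (layerSite d L P : TiltedSite d i j (2 * P) (2 * P) L)) (upAt (layerSite d L P : TiltedSite d i j (2 * P) (2 * P) L)) t U
      ∂(productHaar (TiltedSite d i j (2 * P) (2 * P) L) d G) =
    ∫ U, hEv ρ β F hij U * (SlabKernel.slabKernel₂ (psiE P ρ β) (wA U) (wA (configReflect (tiltedUnit d i j (2 * P) (2 * P) L) i (tiltedAxisFlip d L (2 * P) hij) U)) : ℂ)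
      ∂(productHaar (TiltedSite d i j (2 * P) (2 * P) L) d G) := by
  haveI : IsProbabilityMeasure (haarProbability G) := CompactGroup.isProbabilityMeasure_haarMeasure_top
  have hωc := SlabKernel.continuous_wilsonWt ρ hρ β
  have hωz := SlabKernel.wilsonWt_central ρ β
  have hωi := SlabKernel.wilsonWt_inv ρ hρ β
  have hψc : Continuous (psiE P ρ β) := SlabKernel.continuous_convPow hωc _
  have hψz : ∀ g h, psiE P ρ β (h * g * h⁻¹) = psiE P ρ β g := SlabKernel.convPow_central hωz (2 * P)
  have hψi : ∀ g, psiE P ρ β g⁻¹ = psiE P ρ β g := SlabKernel.convPow_inv hωz hωi (2 * P)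
  obtain ⟨C, -, hC⟩ := Literature.MathematicalPhysics.QuantumLattice.exists_forall_abs_le_of_continuous hωc
  obtain ⟨hhm, Ch, hhb⟩ := measurable_hEv_and_bound ρ hij hρ β hFm hFb
  have hAv : (axisCoord d L (2 * P) (predLayerSite d L P : TiltedSite d i j (2 * P) (2 * P) L)).val = P - 1 := val_axisCoord_predLayerSite hP
  have hBv : (axisCoord d L (2 * P) (layerSite d L P : TiltedSite d i j (2 * P) (2 * P) L)).val = P := val_axisCoord_layerSite hP
  have hm : (1 : ℕ) ≤ 2 * P := by omega
  have hyAv : (axisCoord d L (2 * P) (predLayerSite d L P : TiltedSite d i j (2 * P) (2 * P) L)).val = P - 1 ∨ (axisCoord d L (2 * P) (predLayerSite d L P : TiltedSite d i j (2 * P) (2 * P) L)).val = P := Or.inl hAv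
  have hyBv : (axisCoord d L (2 * P) (layerSite d L P : TiltedSite d i j (2 * P) (2 * P) L)).val = P - 1 ∨ (axisCoord d L (2 * P) (layerSite d L P : TiltedSite d i j (2 * P) (2 * P) L)).val = P := Or.inr hBv
  have hBA : (axisCoord d L (2 * P) (layerSite d L P : TiltedSite d i j (2 * P) (2 * P) L)).val ≠ (axisCoord d L (2 * P) (predLayerSite d L P : TiltedSite d i j (2 * P) (2 * P) L)).val := by rw [hBv, hAv]; omega
  -- the annulus products as functions, their measurability, bounds and invariances
  set pr : TiltedSite d i j (2 * P) (2 * P) L → Config (TiltedSite d i j (2 * P) (2 * P) L) d G → ℂ :=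
    fun y U => ∏ t ∈ Finset.range (2 * (2 * P)), SlabKernel.plaqWt (SlabKernel.wilsonWt ρ β) (rungAt y) (loAt y) (upAt y) t U
    with hpr
  have hprm : ∀ y, Measurable (pr y) := fun y => Finset.measurable_prod _ fun t _ =>
    (SlabKernel.continuous_plaqWt hωc (fun t => continuous_apply _) (fun t => continuous_apply _) t).measurable
  have hprb : ∀ y U, ‖pr y U‖ ≤ C ^ (2 * (2 * P)) := fun y U => by
    rw [hpr, norm_prod]
    calc ∏ t ∈ Finset.range (2 * (2 * P)), ‖SlabKernel.plaqWt (SlabKernel.wilsonWt ρ β) (rungAt y) (loAt y) (upAt y) t U‖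
        ≤ ∏ _t ∈ Finset.range (2 * (2 * P)), C :=
          Finset.prod_le_prod (fun _ _ => norm_nonneg _) fun t _ => SlabKernel.norm_plaqWt_le hC t U
      _ = C ^ (2 * (2 * P)) := by rw [Finset.prod_const, Finset.card_range]
  have hpru : ∀ y y' : TiltedSite d i j (2 * P) (2 * P) L,
      (axisCoord d L (2 * P) y).val ≠ (axisCoord d L (2 * P) y').val →
      ∀ s U z, pr y (update U (rungAt y' s) z) = pr y U := fun y y' hne s U z => by
    simp only [hpr]
    refine Finset.prod_congr rfl fun t _ => ?_
    exact SlabKernel.plaqWt_update_of_ne (rungAt_ne_of_val_ne_even hij hne _ _) (rungAt_ne_of_val_ne_even hij hne _ _)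
      (fun U z => loAt_update hij _ _ _ _ U z) (fun U z => upAt_update hij _ _ _ _ U z) U z
  have hC0 : 0 ≤ C ^ (2 * (2 * P)) := pow_nonneg ((abs_nonneg _).trans (hC 1)) _
  have hCh0 : 0 ≤ Ch := (norm_nonneg _).trans (hhb (fun _ => 1))
  -- Step A: the annulus `P-1|P` (through `y₋`), against `h₁ = h · pr y₀`
  set h₁ : Config (TiltedSite d i j (2 * P) (2 * P) L) d G → ℂ := fun U => hEv ρ β F hij U * pr (layerSite d L P : TiltedSite d i j (2 * P) (2 * P) L) U with hh₁
  have hA : ∀ U, hEv ρ β F hij U * (∏ t ∈ Finset.range (2 * (2 * P)), SlabKernel.plaqWt (SlabKernel.wilsonWt ρ β) (rungAt (predLayerSite d L P : TiltedSite d i j (2 * P) (2 * P) L)) (loAt (predLayerSite d L P : TiltedSite d i j (2 * P) (2 * P) L)) (upAt (predLayerSite d L P : TiltedSite d i j (2 * P) (2 * P) L)) t U) *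
      ∏ t ∈ Finset.range (2 * (2 * P)), SlabKernel.plaqWt (SlabKernel.wilsonWt ρ β) (rungAt (layerSite d L P : TiltedSite d i j (2 * P) (2 * P) L)) (loAt (layerSite d L P : TiltedSite d i j (2 * P) (2 * P) L)) (upAt (layerSite d L P : TiltedSite d i j (2 * P) (2 * P) L)) t U =
      h₁ U * ∏ t ∈ Finset.range (2 * (2 * P)), SlabKernel.plaqWt (SlabKernel.wilsonWt ρ β) (rungAt (predLayerSite d L P : TiltedSite d i j (2 * P) (2 * P) L)) (loAt (predLayerSite d L P : TiltedSite d i j (2 * P) (2 * P) L)) (upAt (predLayerSite d L P : TiltedSite d i j (2 * P) (2 * P) L)) t U := fun U => by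
    simp only [hh₁, hpr]; ring
  simp_rw [hA]
  unfold productHaar
  rw [SlabKernel.integral_mul_annulus (r := rungAt (predLayerSite d L P : TiltedSite d i j (2 * P) (2 * P) L)) (a := loAt (predLayerSite d L P : TiltedSite d i j (2 * P) (2 * P) L)) (b := upAt (predLayerSite d L P : TiltedSite d i j (2 * P) (2 * P) L))
    hωc hωz hm (by simpa using rungAt_add_two_mul hij (predLayerSite d L P : TiltedSite d i j (2 * P) (2 * P) L) 0) (rungAt_inj hij _)
    (fun t => continuous_apply _) (fun t => continuous_apply _) (fun t s U z => loAt_update hij _ _ t s U z)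
    (fun t s U z => upAt_update hij _ _ t s U z) (h := h₁) (hhm.mul (hprm _))
    (K := Ch * C ^ (2 * (2 * P))) (fun U => by
      rw [hh₁, norm_mul]
      exact mul_le_mul (hhb U) (hprb _ U) (norm_nonneg _) hCh0)
    (fun s U z => by simp only [hh₁, hEv_update_rung ρ hP hij hd β hFo hyAv s U z, hpru _ _ hBA])]
  -- Step B: the annulus `P|P+1` (through `y₀`), against `h₂ = h · k_A`
  have hkc : Continuous fun q : G × G => SlabKernel.slabKernel (psiE P ρ β) q.1 q.2 :=
    SlabKernel.continuous_uncurry_slabKernel hψc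
  obtain ⟨Ck, hCk0, hCk⟩ := SlabKernel.exists_abs_slabKernel_le hψc
  have hCk' : ∀ a b : G, ‖(SlabKernel.slabKernel (psiE P ρ β) a b : ℂ)‖ ≤ Ck := fun a b => by
    rw [Complex.norm_real, Real.norm_eq_abs]; exact hCk a b
  obtain ⟨hwA, hwF, hwB⟩ := continuous_wordsE (L := L) (P := P) (i := i) (j := j) (d := d) (G := G)
  set kA : Config (TiltedSite d i j (2 * P) (2 * P) L) d G → ℂ := fun U =>
    (SlabKernel.slabKernel (psiE P ρ β) (wA U) (wF U) : ℂ) with hkA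
  have hkAm : Measurable kA := (Complex.continuous_ofReal.comp (hkc.comp (hwA.prodMk hwF))).measurable
  have hkAb : ∀ U, ‖kA U‖ ≤ Ck := fun U => hCk' _ _
  have hkAu : ∀ (y' : TiltedSite d i j (2 * P) (2 * P) L) s U z, kA (update U (rungAt y' s) z) = kA U := fun y' s U z => by
    simp only [hkA, wA, wF, SlabKernel.oprod_update (fun t U z => loAt_update hij _ _ t s U z),
      SlabKernel.oprod_update (fun t U z => upAt_update hij _ _ t s U z)]
  set h₂ : Config (TiltedSite d i j (2 * P) (2 * P) L) d G → ℂ := fun U => hEv ρ β F hij U * kA U with hh₂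
  have hfold : SlabKernel.convPow (SlabKernel.wilsonWt ρ β) (2 * P) = psiE P ρ β := rfl
  have hB : ∀ U, h₁ U * (SlabKernel.slabKernel (SlabKernel.convPow (SlabKernel.wilsonWt ρ β) (2 * P))
      (SlabKernel.oprod (loAt (predLayerSite d L P : TiltedSite d i j (2 * P) (2 * P) L)) (2 * (2 * P)) U)
      (SlabKernel.oprod (upAt (predLayerSite d L P : TiltedSite d i j (2 * P) (2 * P) L)) (2 * (2 * P)) U) : ℂ) =
      h₂ U * ∏ t ∈ Finset.range (2 * (2 * P)), SlabKernel.plaqWt (SlabKernel.wilsonWt ρ β) (rungAt (layerSite d L P : TiltedSite d i j (2 * P) (2 * P) L)) (loAt (layerSite d L P : TiltedSite d i j (2 * P) (2 * P) L)) (upAt (layerSite d L P : TiltedSite d i j (2 * P) (2 * P) L)) t U := fun U => by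
    simp only [hh₁, hh₂, hkA, hpr, wA, wF, hfold]; ring
  simp_rw [hB]
  rw [SlabKernel.integral_mul_annulus (r := rungAt (layerSite d L P : TiltedSite d i j (2 * P) (2 * P) L)) (a := loAt (layerSite d L P : TiltedSite d i j (2 * P) (2 * P) L)) (b := upAt (layerSite d L P : TiltedSite d i j (2 * P) (2 * P) L)) hωc hωz hm
    (by simpa using rungAt_add_two_mul hij (layerSite d L P : TiltedSite d i j (2 * P) (2 * P) L) 0) (rungAt_inj hij _)
    (fun t => continuous_apply _) (fun t => continuous_apply _) (fun t s U z => loAt_update hij _ _ t s U z)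
    (fun t s U z => upAt_update hij _ _ t s U z) (h := h₂) (hhm.mul hkAm) (K := Ch * Ck)
    (fun U => by
      rw [hh₂, norm_mul]
      exact mul_le_mul (hhb U) (hkAb U) (norm_nonneg _) hCh0)
    (fun s U z => by simp only [hh₂, hEv_update_rung ρ hP hij hd β hFo hyBv s U z, hkAu])]
  -- Step C: one letter of the free layer, against `g = h`
  set Φ₃ : Config (TiltedSite d i j (2 * P) (2 * P) L) d G → ℂ := fun U =>
    (SlabKernel.slabKernel (psiE P ρ β) (wA U) (wF U) : ℂ) * (SlabKernel.slabKernel (psiE P ρ β) (wF U) (wB U) : ℂ)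
    with hΦ₃
  have hCstep : ∀ U, h₂ U * (SlabKernel.slabKernel (SlabKernel.convPow (SlabKernel.wilsonWt ρ β) (2 * P))
      (SlabKernel.oprod (loAt (layerSite d L P : TiltedSite d i j (2 * P) (2 * P) L)) (2 * (2 * P)) U)
      (SlabKernel.oprod (upAt (layerSite d L P : TiltedSite d i j (2 * P) (2 * P) L)) (2 * (2 * P)) U) : ℂ) =
      hEv ρ β F hij U * Φ₃ U := fun U => by
    simp only [hh₂, hΦ₃, hkA, hfold, oprod_loAt_layerSite, wF, wB]; ring
  simp_rw [hCstep]
  have hΦ₃m : Measurable Φ₃ :=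
    ((Complex.continuous_ofReal.comp (hkc.comp (hwA.prodMk hwF))).mul
      (Complex.continuous_ofReal.comp (hkc.comp (hwF.prodMk hwB)))).measurable
  have hΦ₃b : ∀ U, ‖Φ₃ U‖ ≤ Ck * Ck := fun U => by
    rw [hΦ₃, norm_mul]; exact mul_le_mul (hCk' _ _) (hCk' _ _) (norm_nonneg _) hCk0
  have hℓ₀ : (axisCoord d L (2 * P) ((predLayerSite d L P : TiltedSite d i j (2 * P) (2 * P) L) + tiltedUnit d i j (2 * P) (2 * P) L i)).val = P := by
    rw [predLayerSite_add, val_axisCoord_layerSite hP]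
  have hgu : ∀ U z, hEv ρ β F hij (update U ((predLayerSite d L P : TiltedSite d i j (2 * P) (2 * P) L) + tiltedUnit d i j (2 * P) (2 * P) L i, j) z) = hEv ρ β F hij U :=
    fun U z => hEv_update_freeLetter ρ hP hij hd β hFo hℓ₀ U z
  rw [SlabKernel.integral_mul_eq_integral_mul_update ((predLayerSite d L P : TiltedSite d i j (2 * P) (2 * P) L) + tiltedUnit d i j (2 * P) (2 * P) L i, j) hhm hΦ₃m hhb hΦ₃b hgu]
  have hinnerC : ∀ U, ∫ z, Φ₃ (update U ((predLayerSite d L P : TiltedSite d i j (2 * P) (2 * P) L) + tiltedUnit d i j (2 * P) (2 * P) L i, j) z) ∂haarProbability G =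
      (SlabKernel.slabKernel₂ (psiE P ρ β) (wA U) (wB U) : ℂ) := fun U => by
    have hUp : ∀ z, wA (update U ((predLayerSite d L P : TiltedSite d i j (2 * P) (2 * P) L) + tiltedUnit d i j (2 * P) (2 * P) L i, j) z) = wA U := fun z => by
      unfold wA SlabKernel.oprod
      congr 1
      refine List.map_congr_left fun t _ => ?_
      unfold loAt
      rw [update_of_ne]
      intro he
      have h1 := congrArg (fun l => (axisCoord d L (2 * P) l.1).val) he
      simp only [axisCoord_cyc hij, hℓ₀, hAv] at h1
      omega
    have hTop : ∀ z, wB (update U ((predLayerSite d L P : TiltedSite d i j (2 * P) (2 * P) L) + tiltedUnit d i j (2 * P) (2 * P) L i, j) z) = wB U := fun z => by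
      unfold wB SlabKernel.oprod
      congr 1
      refine List.map_congr_left fun t _ => ?_
      unfold upAt
      rw [update_of_ne]
      intro he
      have h1 := congrArg (fun l => (axisCoord d L (2 * P) l.1).val) he
      simp only [val_axisCoord_cyc_layerSite_add hP hij, hℓ₀] at h1
      omega
    have e : ∀ z, Φ₃ (update U ((predLayerSite d L P : TiltedSite d i j (2 * P) (2 * P) L) + tiltedUnit d i j (2 * P) (2 * P) L i, j) z) =
        ((SlabKernel.slabKernel (psiE P ρ β) (wA U)
          (1 * z * SlabKernel.oprod (fun t => upAt (predLayerSite d L P : TiltedSite d i j (2 * P) (2 * P) L) (1 + t)) (2 * (2 * P) - 1) U) *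
        SlabKernel.slabKernel (psiE P ρ β)
          (1 * z * SlabKernel.oprod (fun t => upAt (predLayerSite d L P : TiltedSite d i j (2 * P) (2 * P) L) (1 + t)) (2 * (2 * P) - 1) U) (wB U) : ℝ) : ℂ) :=
      fun z => by
        simp only [hΦ₃, hUp z, hTop z, wF_update hij U z, Complex.ofReal_mul]
    simp_rw [e]
    rw [integral_complex_ofReal, SlabKernel.integral_slabKernel_mul_slabKernel hψc hψz hψi]
  simp_rw [hinnerC]
  -- Step D: the upper word is a conjugate of the reflected lower word
  refine integral_congr_ae (ae_of_all _ fun U => ?_)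
  simp only [wA, wB]
  rw [oprod_upAt_layerSite_eq_conj hij U, SlabKernel.slabKernel₂_conj_right hψz]

end TwoDim

end TiltedRP

end Summit.QuantumFields.GaugeBoot

end
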